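import Summits.QuantumAdvantage.QuantumAdvantage.Theorems.RankDialI2
import HarnessLib

/-!
# RankDial (I3) — §24 the SPAN LAW `WindowSpanLinSel` (PROVED `p ≠ 3`), `windowMixed_of_span`, the SPREAD residual `WindowSpreadLinSel`, `highRank_iff_spread`, `span_dial`

TARGET BY NAME (cell decomp-qadv, RESIDUAL MODE): item stmt-QuantumAdvantage-23109
`Summit.QuantumAdvantage.QuantumAdvantage.Theses.OddPrimeWalk.ManyReadersSqrtOdd`, through rung R5 = `AdviceFreeQNC0.WalkHardFLinSel p`.
This file SUPPORTS the item (`--supports`); it does not close it.  Declaration bodies are byte-identical to the cell node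
«SpanDial» (decomp-qadv lens-1, generation 26, part I; node file RankDialI.lean, whose §1–§21 are node «MixedDial» =
parts G1–G2, H1–H3), cut into ≤ 400-line parts
I1 (§22 indicator closure and the `p^d` composition bound) → I2 (§23 the wide-rank grade `WRankLE`, span fibre and window theorems) → I3 (§24 pieces `WindowSpanLinSel` PROVED `p ≠ 3`, residual `WindowSpreadLinSel`, `span_dial`);
see the node file for the mechanism summary.
-/

set_option linter.dupNamespace false
set_option autoImplicit false

noncomputable section
open Classical

namespace Summit.QuantumAdvantage.QuantumAdvantage.Theorems.RankDial

open Finset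
open Summit.QuantumAdvantage.AdviceFreeQNC0
open Literature.Computability.MetaComplexity Literature.Computability.MetaComplexity.Smolensky

/-! ### §24 The pieces: the SPAN LAW (proved for `p ≠ 3`), its corollaries, and the SPREAD residual -/

section SpanPieces
variable (p : ℕ) [Fact p.Prime]

/-- **PIECE `WindowSpanLinSel p`** (the span grade, linear tests): for every width `s` there are `θ < 1` and a budget
unit `M` such that a linear-test strategy with a cut-free window of length `ℓ`, ANY number of cuts of window support
`≤ s`, and wide cuts (support `> s`) answering on every fibre through `D` linear forms of the window with
`(p·D + 2)·M ≤ ℓ`, wins on `≤ θ·2ⁿ` inputs.  [NECESSARY · contains the mixed piece (`D = #wide`, `windowMixed_of_span`)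
hence the junta and few-readers pieces · **PROVED for every prime `p ≠ 3`**: `windowSpanLinSel_holds` (`θ = 11/12`,
`M = ⌈2·4^{s+1}/η_p⌉`).] -/
def WindowSpanLinSel : Prop :=
  ∀ s : ℕ, ∃ θ : ℝ, θ < 1 ∧ ∃ M : ℕ, ∀ L ℓ R : ℕ,
    ∀ (c : ℕ) (y : Fin (L + ℓ + R + 1) → (Fin (L + ℓ + R) → Bool) → Bool)
      (lam : Fin (L + ℓ + R + 1) → Fin (L + ℓ + R) → ZMod p) (rr : Fin (L + ℓ + R + 1) → ZMod p),
      (∀ g u, y g u = decide ((∑ i, if u i then lam g i else 0) = rr g)) → CutFree y L ℓ →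
      ∀ D : ℕ, WRankLE p y lam s D → (p * D + 2) * M ≤ ℓ →
      ((univ.filter fun u : Fin (L + ℓ + R) → Bool => ringWinU c y u = true).card : ℝ) ≤ θ * (2 : ℝ) ^ (L + ℓ + R)

/-- **THE SPAN LAW IS A THEOREM** for every prime `p ≠ 3` (`θ = 11/12`). -/
theorem windowSpanLinSel_holds (hp3 : p ≠ 3) : WindowSpanLinSel p := by
  intro s
  obtain ⟨M, hM⟩ : ∃ M : ℕ, 2 * 4 ^ (s + 1) ≤ (M : ℝ) * etaP p := by
    obtain ⟨M, hM⟩ := exists_nat_ge (2 * 4 ^ (s + 1) / etaP p)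
    exact ⟨M, by rwa [div_le_iff₀ (etaP_pos (p := p))] at hM⟩
  refine ⟨11 / 12, by norm_num, M, fun L ℓ R c y lam rr hyl hgap D hWR hℓ => ?_⟩
  have h := window_bound_wrank hp3 L ℓ R c y lam rr hyl hgap hM hWR hℓ
  have h' : (12 : ℝ) * ((univ.filter fun u : Fin (L + ℓ + R) → Bool => ringWinU c y u = true).card : ℝ) ≤
      11 * (2 : ℝ) ^ (L + ℓ + R) := by exact_mod_cast h
  linarith

/-- NECESSARY: rung R5 implies the span piece (sanity). -/
theorem windowSpan_of_r5 (h : WalkHardFLinSel p) : WindowSpanLinSel p := by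
  intro s
  obtain ⟨θ, hθ, n₀, h⟩ := h
  refine ⟨θ, hθ, n₀, fun L ℓ R c y lam rr hyl _ D _ hℓ => ?_⟩
  have h2 : 2 * n₀ ≤ (p * D + 2) * n₀ := Nat.mul_le_mul_right _ (by omega)
  have hn : n₀ ≤ L + ℓ + R := by omega
  exact h (L + ℓ + R) hn c y fun g => ⟨lam g, rr g, hyl g⟩

/-- **The span law contains the mixed law** (`D = #wide(s)`, budget unit `p·M`). -/
theorem windowMixed_of_span (h : WindowSpanLinSel p) : WindowMixedLinSel p := by
  intro s
  obtain ⟨θ, hθ, M, h⟩ := h s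
  refine ⟨θ, hθ, p * M, fun L ℓ R c y lam rr hyl hgap hℓ => ?_⟩
  have hWR : WRankLE p y lam s (wideCuts lam s).card := wRankLE_of_card_le y lam rr hyl s le_rfl
  refine h L ℓ R c y lam rr hyl hgap _ hWR ?_
  have hp1 : 1 ≤ p := (Fact.out : p.Prime).one_lt.le
  have hw : (wideCuts lam s).card = (univ.filter fun g : Fin (L + ℓ + R + 1) => s < (wsupp lam g).card).card := rfl
  set k := (univ.filter fun g : Fin (L + ℓ + R + 1) => s < (wsupp lam g).card).card with hk
  rw [hw]
  have h1 : (p * k + 2) * M ≤ (p * k + 2 * p) * M := Nat.mul_le_mul_right _ (by omega)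
  have h2 : (p * k + 2 * p) * M = (k + 2) * (p * M) := by ring
  omega

/-- **PIECE `WindowSpreadLinSel p s`** (the residual of the high-rank piece after the span law): the window law
restricted to SPREAD windows — the wide cuts (window support `> s` in the given linear representation) do NOT answer
through `ℓ/E` linear forms on the fibres; in particular there are more than `ℓ/E` of them and they are linearly
independent beyond dimension `ℓ/E`.  [NECESSARY (`spread_of_highRank`) · implied by the crowd piece
(`spread_of_crowd`) · with the span law EQUIVALENT to the high-rank piece (`highRank_iff_spread`) · IDEA-NEEDED:
many linearly independent wide forms with large common support (e.g. `|v| + t·v_i mod p`, one per site) — neither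
the degree nor the character budget of this file is linear in their number.] -/
def WindowSpreadLinSel (s : ℕ) : Prop :=
  ∀ E : ℕ, 0 < E → ∃ θ : ℝ, θ < 1 ∧ ∃ C : ℕ, ∃ n₀ : ℕ, ∀ L ℓ R : ℕ, n₀ ≤ L + ℓ + R →
    C * (Nat.log 2 (L + ℓ + R) + 1) ≤ ℓ →
    ∀ (c : ℕ) (y : Fin (L + ℓ + R + 1) → (Fin (L + ℓ + R) → Bool) → Bool)
      (lam : Fin (L + ℓ + R + 1) → Fin (L + ℓ + R) → ZMod p) (rr : Fin (L + ℓ + R + 1) → ZMod p),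
      (∀ g u, y g u = decide ((∑ i, if u i then lam g i else 0) = rr g)) → CutFree y L ℓ →
      ¬ WRankLE p y lam s (ℓ / E) →
      ((univ.filter fun u : Fin (L + ℓ + R) → Bool => ringWinU c y u = true).card : ℝ) ≤ θ * (2 : ℝ) ^ (L + ℓ + R)

/-- NECESSARY: the high-rank piece implies the spread piece (a spread window has high rank). -/
theorem spread_of_highRank (s : ℕ) (h : WindowHighRankLinSel p) : WindowSpreadLinSel p s := by
  intro E hE
  obtain ⟨θ, hθ, C, n₀, h⟩ := h E hE
  exact ⟨θ, hθ, C, n₀, fun L ℓ R hn hC c y lam rr hyl hgap hW =>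
    h L ℓ R hn hC c y (fun g => ⟨lam g, rr g, hyl g⟩) hgap fun hr => hW (wRankLE_of_rankLE y lam s hr)⟩

/-- **The residual shrank**: the crowd piece implies the spread piece (a spread window is crowded and of high rank). -/
theorem spread_of_crowd (s : ℕ) (h : WindowCrowdLinSel p s) : WindowSpreadLinSel p s := by
  intro E hE
  obtain ⟨θ, hθ, C, n₀, h⟩ := h E hE
  refine ⟨θ, hθ, C, n₀, fun L ℓ R hn hC c y lam rr hyl hgap hW => h L ℓ R hn hC c y lam rr hyl hgap
    (fun hr => hW (wRankLE_of_rankLE y lam s hr)) ?_⟩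
  by_contra hk
  exact hW (wRankLE_of_card_le y lam rr hyl s (not_lt.1 hk))

/-- **The span law shrinks the residual**: span law ∧ spread piece ⟹ high-rank piece. -/
theorem highRank_of_span_spread (s : ℕ) (hSp : WindowSpanLinSel p) (hSd : WindowSpreadLinSel p s) :
    WindowHighRankLinSel p := by
  intro E hE
  have hp1 : 1 ≤ p := (Fact.out : p.Prime).one_lt.le
  obtain ⟨θ₁, hθ₁, M, hSp⟩ := hSp s
  set E' := max E (3 * (p * (M + 1))) with hE'
  have hE'pos : 0 < E' := lt_of_lt_of_le hE (le_max_left _ _)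
  obtain ⟨θ₂, hθ₂, C₂, n₂, hSd⟩ := hSd E' hE'pos
  refine ⟨max θ₁ θ₂, max_lt hθ₁ hθ₂, max C₂ (3 * (M + 1)), n₂, fun L ℓ R hn hCle c y hy hgap _ => ?_⟩
  have hlog : 1 ≤ Nat.log 2 (L + ℓ + R) + 1 := Nat.le_add_left 1 _
  have hC₂ : C₂ * (Nat.log 2 (L + ℓ + R) + 1) ≤ ℓ :=
    le_trans (Nat.mul_le_mul_right _ (le_max_left C₂ _)) hCle
  have h3M : 3 * (M + 1) ≤ ℓ :=
    le_trans (le_trans (le_max_right C₂ _) (Nat.le_mul_of_pos_right _ hlog)) hCle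
  have hpos : (0 : ℝ) ≤ (2 : ℝ) ^ (L + ℓ + R) := by positivity
  choose lam rr hyl using hy
  by_cases hW : WRankLE p y lam s (ℓ / E')
  · -- few independent wide forms: the span law
    set q := ℓ / (3 * (p * (M + 1))) with hq
    have hqE : ℓ / E' ≤ q := Nat.div_le_div_left (le_max_right _ _) (by positivity)
    have hqmul : q * (3 * (p * (M + 1))) ≤ ℓ := Nat.div_mul_le_self ℓ _
    have hA : 3 * (p * q * M) ≤ ℓ := by
      have h1 : 3 * (p * q * M) ≤ q * (3 * (p * (M + 1))) := by nlinarith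
      omega
    have hbudget : (p * (ℓ / E') + 2) * M ≤ ℓ := by
      have h1 : (p * (ℓ / E') + 2) * M ≤ (p * q + 2) * M :=
        Nat.mul_le_mul_right _ (by nlinarith)
      have h2 : (p * q + 2) * M = p * q * M + 2 * M := by ring
      omega
    exact le_trans (hSp L ℓ R c y lam rr hyl hgap _ hW hbudget)
      (mul_le_mul_of_nonneg_right (le_max_left θ₁ θ₂) hpos)
  · exact le_trans (hSd L ℓ R hn hC₂ c y lam rr hyl hgap hW) (mul_le_mul_of_nonneg_right (le_max_right θ₁ θ₂) hpos)

/-- With the span law a theorem, the spread piece IS the high-rank piece (every `s`, `p ≠ 3`). -/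
theorem highRank_iff_spread (hp3 : p ≠ 3) (s : ℕ) : WindowHighRankLinSel p ↔ WindowSpreadLinSel p s :=
  ⟨spread_of_highRank p s, highRank_of_span_spread p s (windowSpanLinSel_holds p hp3)⟩

/-- **Residual of rung R5 after the span law** (`p ≥ 5`, any `s`): spread windows and the no-window core. -/
theorem r5_residual_spread (hp : 5 ≤ p) (s : ℕ) (hSd : WindowSpreadLinSel p s) (hN : NoWindowLinSel p) :
    WalkHardFLinSel p :=
  r5_residual hp (highRank_of_span_spread p s (windowSpanLinSel_holds p (by omega)) hSd) hN

/-- **THE SPAN DIAL** (`p ≥ 5`): the span law holds and contains the mixed law; the spread piece is the high-rank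
piece and is implied by the crowd piece; spread ∧ no-window ⟹ R5. -/
theorem span_dial (hp : 5 ≤ p) :
    WindowSpanLinSel p ∧ (WindowSpanLinSel p → WindowMixedLinSel p) ∧
      (∀ s, (WindowHighRankLinSel p ↔ WindowSpreadLinSel p s)) ∧
      (∀ s, WindowCrowdLinSel p s → WindowSpreadLinSel p s) ∧
      (∀ s, WindowSpreadLinSel p s → NoWindowLinSel p → WalkHardFLinSel p) :=
  ⟨windowSpanLinSel_holds p (by omega), windowMixed_of_span p, highRank_iff_spread p (by omega),
    spread_of_crowd p, r5_residual_spread p hp⟩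

end SpanPieces

end Summit.QuantumAdvantage.QuantumAdvantage.Theorems.RankDial

end
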